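import Mathlib.Analysis.Calculus.ContDiff.Convolution
import Mathlib.Analysis.Calculus.BumpFunction.Normed
import Mathlib.Analysis.Calculus.BumpFunction.FiniteDimension
import Mathlib.MeasureTheory.Measure.Haar.Unique
import Mathlib.Topology.MetricSpace.Thickening
import HarnessLib

/-!
# Smooth cutoff functions with bounded derivatives for uniform neighbourhoods of closed sets

Topic `Literature/Analysis/Distribution`. Hörmander's cutoff lemma (Thm. 1.4.1 with the estimate
(1.4.2), pdf p. 25 of the held 2003 printing): for a set `S` in a finite-dimensional real normed
space and `δ > 0` there is `χ ∈ C^∞` with `0 ≤ χ ≤ 1`, `χ = 1` on the `δ`-neighbourhood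
`thickening δ S`, `tsupport χ ⊆ thickening (3δ) S`, and **all derivatives of `χ` bounded**
(`exists_smooth_cutoff`). Printed for compact `K` ("then one can find `φ ∈ C₀^∞(X)` with
`0 ≤ φ ≤ 1` so that `φ = 1` in a neighborhood of `K`", proof: `φ = v * χ_ε` with `v` the
characteristic function of `K_{2ε}`, "`|∂^α φ| ≤ ∫ |∂^α χ_ε| dx`", (1.4.2)); the printed proof uses
compactness only to have `ε > 0`, and is carried out here for an arbitrary set and a given
`δ = ε`: `χ = 1_{S_{2δ}} ⋆ ρ` with `ρ` a normalised bump supported in the ball of radius `δ/2`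
(Mathlib's `ContDiffBump.normed`), and `Dⁿχ = 1_{S_{2δ}} ⋆ Dⁿρ`
(`iteratedFDeriv_convolution_right`, by induction on `n` from Mathlib's
`HasCompactSupport.hasFDerivAt_convolution_right`), whence `‖Dⁿχ‖ ≤ ∫ ‖Dⁿρ‖`
(`norm_iteratedFDeriv_convolution_right_le`). This is the cutoff used to localise a tempered
distribution with support in a closed cone to a uniform neighbourhood of the cone in the
Fourier–Laplace representation (Hörmander Thm. 7.4.2 / Streater–Wightman Thm. 2-6; sibling files).

## References

* L. Hörmander, *The Analysis of Linear Partial Differential Operators I*, 2nd ed., §1.4,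
  Thm. 1.4.1 and eq. (1.4.2). [HormanderALPDO1]

## Mathlib

Used: `MeasureTheory.convolution` with `ContinuousLinearMap.lsmul`,
`HasCompactSupport.hasFDerivAt_convolution_right`, `HasCompactSupport.contDiff_convolution_right`,
`ContDiffBump.normed` (`integral_normed`, `support_normed_eq`), `iteratedFDeriv_succ_eq_comp_left`,
`LinearIsometry.integral_comp_comm`, `integral_sub_left_eq_self`, `Metric.thickening`. Mathlib has
smooth bump functions and Urysohn-type lemmas (`exists_smooth_zero_one_of_isClosed`) but no cutoff
with uniformly bounded derivatives for a non-compact set (searched `iteratedFDeriv.*convolution`,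
`thickening.*ContDiff`: no hits).
-/

noncomputable section

open MeasureTheory Metric Set Function ContinuousLinearMap Filter
open scoped Convolution ContDiff Topology

namespace Literature.Analysis.Distribution

/-! ### Derivatives of a mollification -/

section Mollifier

variable {V : Type*} [NormedAddCommGroup V] [NormedSpace ℝ V] [FiniteDimensional ℝ V]
  [MeasurableSpace V] [BorelSpace V] {μ : Measure V} [μ.IsAddHaarMeasure]

/-- **Derivatives of a mollification**: for `v` locally integrable and `ρ` smooth with compact
support, `Dⁿ(v ⋆ ρ)(x) = ∫ v(t) Dⁿρ(x − t) dt` (Hörmander (1990), Thm. 1.3.1 / proof of Thm. 1.4.1,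
"`∂^α(v * χ_ε) = v * ∂^α χ_ε`"). [cite: HormanderALPDO1, Thm 1.4.1] -/
theorem iteratedFDeriv_convolution_right {v : V → ℝ} (hv : LocallyIntegrable v μ) {ρ : V → ℝ}
    (hρ : ContDiff ℝ ∞ ρ) (hρc : HasCompactSupport ρ) (n : ℕ) (x : V) :
    iteratedFDeriv ℝ n (v ⋆[lsmul ℝ ℝ, μ] ρ) x = ∫ t, v t • iteratedFDeriv ℝ n ρ (x - t) ∂μ := by
  induction n generalizing x with
  | zero =>
    have h1 : ∀ t, v t • iteratedFDeriv ℝ 0 ρ (x - t) =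
        (continuousMultilinearCurryFin0 ℝ V ℝ).symm.toLinearIsometry (v t • ρ (x - t)) := by
      intro t
      rw [iteratedFDeriv_zero_eq_comp, Function.comp_apply,
        LinearIsometryEquiv.coe_toLinearIsometry, map_smul]
    simp_rw [h1]
    rw [LinearIsometry.integral_comp_comm, iteratedFDeriv_zero_eq_comp, Function.comp_apply,
      convolution_lsmul]
    rfl
  | succ n ih =>
    have hfun : iteratedFDeriv ℝ n (v ⋆[lsmul ℝ ℝ, μ] ρ) =
        v ⋆[lsmul ℝ ℝ, μ] (iteratedFDeriv ℝ n ρ) := by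
      funext y
      rw [ih y, convolution_lsmul]
    have hρn : ContDiff ℝ 1 (iteratedFDeriv ℝ n ρ) :=
      hρ.iteratedFDeriv_right (i := n) (m := 1) (by exact_mod_cast le_top)
    have hρnc : HasCompactSupport (iteratedFDeriv ℝ n ρ) := hρc.iteratedFDeriv n
    have hderiv := hρnc.hasFDerivAt_convolution_right (lsmul ℝ ℝ) hv hρn x
    rw [iteratedFDeriv_succ_eq_comp_left, Function.comp_apply, hfun, hderiv.fderiv,
      convolution_def]
    have h2 : ∀ t, ((lsmul ℝ ℝ).precompR V) (v t) (fderiv ℝ (iteratedFDeriv ℝ n ρ) (x - t)) =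
        v t • fderiv ℝ (iteratedFDeriv ℝ n ρ) (x - t) := by
      intro t
      ext w m
      simp
    simp_rw [h2]
    set e := (continuousMultilinearCurryLeftEquiv ℝ (fun _ : Fin (n + 1) => V) ℝ).symm with he
    have h4 := LinearIsometry.integral_comp_comm (𝕜 := ℝ) (μ := μ) e.toLinearIsometry
      (fun t => v t • fderiv ℝ (iteratedFDeriv ℝ n ρ) (x - t))
    change e.toLinearIsometry (∫ t, v t • fderiv ℝ (iteratedFDeriv ℝ n ρ) (x - t) ∂μ) = _
    rw [← h4]
    congr 1

/-- **Bound on the derivatives of a mollification**: if `|v| ≤ M` then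
`‖Dⁿ(v ⋆ ρ)(x)‖ ≤ M ∫ ‖Dⁿρ‖` (Hörmander (1990), (1.4.2): "`|∂^α φ| ≤ ∫ |∂^α χ_ε| dx`").
[cite: HormanderALPDO1, Thm 1.4.1 eq (1.4.2)] -/
theorem norm_iteratedFDeriv_convolution_right_le {v : V → ℝ} (hv : LocallyIntegrable v μ) {M : ℝ}
    (hvM : ∀ t, ‖v t‖ ≤ M) {ρ : V → ℝ} (hρ : ContDiff ℝ ∞ ρ) (hρc : HasCompactSupport ρ) (n : ℕ)
    (x : V) :
    ‖iteratedFDeriv ℝ n (v ⋆[lsmul ℝ ℝ, μ] ρ) x‖ ≤ M * ∫ t, ‖iteratedFDeriv ℝ n ρ t‖ ∂μ := by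
  rw [iteratedFDeriv_convolution_right hv hρ hρc]
  have hcont : Continuous fun t => ‖iteratedFDeriv ℝ n ρ t‖ :=
    (hρ.continuous_iteratedFDeriv (by exact_mod_cast le_top)).norm
  have hint0 : Integrable (fun t => ‖iteratedFDeriv ℝ n ρ t‖) μ :=
    hcont.integrable_of_hasCompactSupport (hρc.iteratedFDeriv n).norm
  have hint : Integrable (fun t => M * ‖iteratedFDeriv ℝ n ρ (x - t)‖) μ :=
    (hint0.comp_sub_left x).const_mul M
  calc ‖∫ t, v t • iteratedFDeriv ℝ n ρ (x - t) ∂μ‖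
      ≤ ∫ t, M * ‖iteratedFDeriv ℝ n ρ (x - t)‖ ∂μ :=
        norm_integral_le_of_norm_le hint (Eventually.of_forall fun t => by
          rw [norm_smul]
          exact mul_le_mul_of_nonneg_right (hvM t) (norm_nonneg _))
    _ = M * ∫ t, ‖iteratedFDeriv ℝ n ρ t‖ ∂μ := by
        rw [integral_const_mul]
        congr 1
        exact integral_sub_left_eq_self (fun t => ‖iteratedFDeriv ℝ n ρ t‖) μ x

/-- The value of a mollification `v ⋆ ρ` by a normalised bump `ρ` at a point around which `v` is
constant on the ball of radius `rOut`: `(v ⋆ ρ)(x) = c` (Hörmander (1990), (1.3.11)). [folklore] -/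
theorem convolution_normed_eq_of_eqOn_ball {v : V → ℝ} (φ : ContDiffBump (0 : V)) {x : V} {c : ℝ}
    (hc : ∀ t ∈ ball x φ.rOut, v t = c) :
    (v ⋆[lsmul ℝ ℝ, μ] φ.normed μ) x = c := by
  rw [convolution_lsmul]
  have h : ∀ t, v t • φ.normed μ (x - t) = c • φ.normed μ (x - t) := by
    intro t
    by_cases ht : t ∈ ball x φ.rOut
    · rw [hc t ht]
    · have h0 : φ.normed μ (x - t) = 0 := by
        rw [← Function.notMem_support, φ.support_normed_eq]
        rwa [mem_ball_zero_iff, ← dist_eq_norm, dist_comm] 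
      rw [h0, smul_zero, smul_zero]
  simp_rw [h]
  rw [integral_smul, integral_sub_left_eq_self (fun t => φ.normed μ t) μ x, φ.integral_normed,
    smul_eq_mul, mul_one]

end Mollifier

/-! ### The cutoff -/

/-- **Smooth cutoff for a uniform neighbourhood, with bounded derivatives** (Hörmander (1990),
Thm. 1.4.1 with (1.4.2), for an arbitrary set instead of a compact one — the printed proof applies
verbatim once `ε = δ` is given): for `S ⊆ V` (`V` a finite-dimensional real normed space) and
`δ > 0` there is `χ ∈ C^∞(V)` with `0 ≤ χ ≤ 1`, `χ = 1` on `thickening δ S = {x | dist(x, S) < δ}`,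
`tsupport χ ⊆ thickening (3δ) S`, and `sup_x ‖Dⁿχ(x)‖ < ∞` for every `n`.
[cite: HormanderALPDO1, Thm 1.4.1 eq (1.4.2)] -/
theorem exists_smooth_cutoff {V : Type*} [NormedAddCommGroup V] [NormedSpace ℝ V]
    [FiniteDimensional ℝ V] (S : Set V) {δ : ℝ} (hδ : 0 < δ) :
    ∃ χ : V → ℝ, ContDiff ℝ ∞ χ ∧ (∀ x, 0 ≤ χ x) ∧ (∀ x, χ x ≤ 1) ∧
      (∀ x ∈ thickening δ S, χ x = 1) ∧ tsupport χ ⊆ thickening (3 * δ) S ∧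
      ∀ n : ℕ, ∃ C : ℝ, ∀ x, ‖iteratedFDeriv ℝ n χ x‖ ≤ C := by
  borelize V
  set μ : Measure V := Measure.addHaar
  let φ : ContDiffBump (0 : V) := ⟨δ / 4, δ / 2, by positivity, by linarith⟩
  have hφ : φ.rOut = δ / 2 := rfl
  set A : Set V := thickening (2 * δ) S with hA
  set v : V → ℝ := A.indicator fun _ => (1 : ℝ) with hv
  have hv01 : ∀ t, v t = 0 ∨ v t = 1 := fun t => by
    by_cases ht : t ∈ A <;> simp [hv, ht]
  have hv0 : ∀ t, 0 ≤ v t := fun t => by rcases hv01 t with h | h <;> simp [h]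
  have hv1 : ∀ t, v t ≤ 1 := fun t => by rcases hv01 t with h | h <;> simp [h]
  have hvn : ∀ t, ‖v t‖ ≤ 1 := fun t => by
    rw [Real.norm_of_nonneg (hv0 t)]
    exact hv1 t
  have hvli : LocallyIntegrable v μ :=
    (locallyIntegrable_const (1 : ℝ)).indicator isOpen_thickening.measurableSet
  have hρ : ContDiff ℝ ∞ (φ.normed μ) := φ.contDiff_normed
  have hρc : HasCompactSupport (φ.normed μ) := φ.hasCompactSupport_normed
  refine ⟨v ⋆[lsmul ℝ ℝ, μ] φ.normed μ, hρc.contDiff_convolution_right _ hvli hρ, ?_, ?_, ?_, ?_,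
    fun n => ⟨1 * ∫ t, ‖iteratedFDeriv ℝ n (φ.normed μ) t‖ ∂μ, fun x =>
      norm_iteratedFDeriv_convolution_right_le hvli hvn hρ hρc n x⟩⟩
  · -- `0 ≤ χ`
    intro x
    rw [convolution_lsmul]
    exact integral_nonneg fun t => smul_nonneg (hv0 t) (φ.nonneg_normed _)
  · -- `χ ≤ 1`
    intro x
    rw [convolution_lsmul]
    have hint : Integrable (fun t => φ.normed μ (x - t)) μ := φ.integrable_normed.comp_sub_left x
    calc ∫ t, v t • φ.normed μ (x - t) ∂μ ≤ ∫ t, φ.normed μ (x - t) ∂μ := by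
          refine integral_mono_of_nonneg (Eventually.of_forall fun t =>
            smul_nonneg (hv0 t) (φ.nonneg_normed _)) hint (Eventually.of_forall fun t => ?_)
          simpa using mul_le_of_le_one_left (φ.nonneg_normed (x - t)) (hv1 t)
      _ = 1 := by
          rw [integral_sub_left_eq_self (fun t => φ.normed μ t) μ x]
          exact φ.integral_normed
  · -- `χ = 1` on the `δ`-neighbourhood
    intro x hx
    obtain ⟨z, hz, hxz⟩ := mem_thickening_iff.1 hx
    refine convolution_normed_eq_of_eqOn_ball φ fun t ht => ?_
    have htA : t ∈ A := by
      rw [hA, mem_thickening_iff]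
      refine ⟨z, hz, ?_⟩
      rw [mem_ball, hφ] at ht
      calc dist t z ≤ dist t x + dist x z := dist_triangle _ _ _
        _ < δ / 2 + δ := add_lt_add ht hxz
        _ ≤ 2 * δ := by linarith
    simp [hv, htA]
  · -- support
    have hsupp : support (v ⋆[lsmul ℝ ℝ, μ] φ.normed μ) ⊆ thickening (5 * δ / 2) S := by
      intro x hx
      rw [mem_support] at hx
      by_contra hxS
      apply hx
      refine convolution_normed_eq_of_eqOn_ball φ fun t ht => ?_
      have htA : t ∉ A := by
        intro htA
        rw [hA, mem_thickening_iff] at htA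
        obtain ⟨z, hz, htz⟩ := htA
        apply hxS
        rw [mem_thickening_iff]
        refine ⟨z, hz, ?_⟩
        rw [mem_ball, hφ, dist_comm] at ht
        calc dist x z ≤ dist x t + dist t z := dist_triangle _ _ _
          _ < δ / 2 + 2 * δ := add_lt_add ht htz
          _ = 5 * δ / 2 := by ring
      simp [hv, htA]
    calc tsupport (v ⋆[lsmul ℝ ℝ, μ] φ.normed μ)
        ⊆ closure (thickening (5 * δ / 2) S) := closure_mono hsupp
      _ ⊆ cthickening (5 * δ / 2) S := closure_thickening_subset_cthickening _ _
      _ ⊆ thickening (3 * δ) S := cthickening_subset_thickening' (by linarith) (by linarith) _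

end Literature.Analysis.Distribution
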